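import Summits.CriticalPhenomena.PercolationContinuityZ3.Theorems.PercNearOneGluingNoHeavyLowerTailFKClusterTreeDefs
import Summits.CriticalPhenomena.PercolationContinuityZ3.Theorems.PercNearOneGluingNoHeavyLowerTailFKTreeHarris
import Literature.Probability.Percolation.SetClusterExploration
import Literature.Probability.Percolation.TwoClusterConditionalAssociation
import HarnessLib

/-!
# FK sub-lane: the cluster-conditional Harris inequality for `φ_{𝐩,q}` (decision-tree Harris along the exploration of `C_v`)

Support file (`--supports stmt-CriticalPhenomena-4575`), FK sub-lane `prim-bschramm-fk-2` (gen 3); builds on p205010 (kernel theorem,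
internal audit signed; external expert review pending).  No definitions, no named facts, no sorries; standard axioms.

The input (CE) of prim-hp-7's Lemma `P_v` (HP7-MDLX-PROOF §1, §6) for the random-cluster measure: for `φ = rcMeasureW w q B`, `q ≥ 1`,
a vertex `v` and increasing events `A, A'`,
  `φ(A)·φ(A') ≤ Σ_ω φ{ω} · φ(A | C_v = C_v(ω)) · φ(A' | C_v = C_v(ω))`,                                (`FK.clusterHarris_rc`)
i.e. `Cov(E[1_A | σ(C_v)], E[1_{A'} | σ(C_v)]) ≥ 0` — Gladkov's decision-tree Harris inequality (`FK.treeHarris_rc`, p211170, every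
decision tree) along the FULL EXPLORATION of the open cluster of `v` (`SetClusterExploration.ttree` over the non-loop pairs, converted by
`FK.dtrOfDTree`), whose cylinders are exactly the events `{C_v = W}` (`FK.cyl_clusterTree_eq`: the revealed pairs are the non-loop pairs
meeting the cluster, `SetClusterExploration.mem_revealedAt_iff`/`mem_reached_iff`, and agreement on them is equivalent to having the same open
edge cluster, `SetClusterExploration.fin_congr`).  bschramm/FK-Q2.md §12.3.
[cite: Gladkov2024, Def. 2.4, Example 2.5 (p. 3), Thm. 3.2 (p. 4)] [cite: Grimmett2006, Thm. (3.7) (p. 39), Thm. (3.8)(b)]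
-/

noncomputable section

namespace Summit.CriticalPhenomena.PercolationContinuityZ3.Theorems.FK

open MeasureTheory Set
open Literature.Probability.LatticeModels Literature.Probability.Percolation
open Literature.Probability.Percolation.DecisionTree (revealed)
open Literature.Probability.Percolation.SetClusterExploration (ttree init revealedAt reached revealedAt_eq_revealed mem_revealedAt_iff
  mem_reached_iff fin_congr)
open Summit.CriticalPhenomena.PercolationContinuityZ3.Theorems.MonotonicTree (DTr)
open scoped Classical

variable {V : Type*} [Fintype V]

/-! ### The cylinders of a converted tree -/

omit [Fintype V] in
/-- The cylinder of the converted tree at `ω` is the set of configurations agreeing with `ω` on the coordinates revealed along `ω`.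
[cite: Gladkov2024, Def. 2.4 (p. 3)] -/
theorem cyl_dtrOfDTree {ι : Type*} [DecidableEq ι] (T : DTree ι) (S : Finset ι) (ω : Set ι) (hS : ∀ e, e ∈ S ↔ e ∈ ω) :
    (dtrOfDTree T).cyl (fun e => {ω' : Set ι | e ∈ ω'}) ω = {ω' : Set ι | ∀ e ∈ revealed T S, (e ∈ ω' ↔ e ∈ ω)} := by
  induction T with
  | leaf =>
    simp only [dtrOfDTree, DTr.cyl_leaf, revealed, Finset.notMem_empty, IsEmpty.forall_iff, implies_true, Set.setOf_true]
  | node e yes no ihy ihn =>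
    by_cases he : e ∈ ω
    · have heS : e ∈ S := (hS e).2 he
      show DTr.cyl (fun e => {ω' : Set ι | e ∈ ω'}) (DTr.node e (dtrOfDTree no) (dtrOfDTree yes)) ω = _
      rw [DTr.cyl_node_of_mem (fun e => {ω' : Set ι | e ∈ ω'}) (dtrOfDTree no) (dtrOfDTree yes)
        (show ω ∈ (fun e => {ω' : Set ι | e ∈ ω'}) e from he), ihy]
      ext ω'
      simp only [revealed, if_pos heS, Finset.mem_insert, forall_eq_or_imp, Set.mem_inter_iff, Set.mem_setOf_eq]
      exact ⟨fun ⟨h1, h2⟩ => ⟨⟨fun _ => he, fun _ => h1⟩, h2⟩, fun ⟨h1, h2⟩ => ⟨h1.2 he, h2⟩⟩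
    · have heS : e ∉ S := fun h => he ((hS e).1 h)
      show DTr.cyl (fun e => {ω' : Set ι | e ∈ ω'}) (DTr.node e (dtrOfDTree no) (dtrOfDTree yes)) ω = _
      rw [DTr.cyl_node_of_not_mem (fun e => {ω' : Set ι | e ∈ ω'}) (dtrOfDTree no) (dtrOfDTree yes)
        (show ω ∉ (fun e => {ω' : Set ι | e ∈ ω'}) e from he), ihn]
      ext ω'
      simp only [revealed, if_neg heS, Finset.mem_insert, forall_eq_or_imp, Set.mem_inter_iff, Set.mem_compl_iff, Set.mem_setOf_eq]
      exact ⟨fun ⟨h1, h2⟩ => ⟨⟨fun h => absurd h h1, fun h => absurd h he⟩, h2⟩, fun ⟨h1, h2⟩ => ⟨fun h => he (h1.1 h), h2⟩⟩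

/-! ### The exploration tree of the cluster of `v` -/

/-- The open graph of the non-loop part of a configuration is the open graph of the configuration. [folklore] -/
theorem openGraph_filter_nonDiag (ω : BondConfig V) :
    openGraph (↑((Finset.univ.filter fun e : Sym2 V => e ∈ ω) ∩ (Finset.univ.filter fun e : Sym2 V => ¬ e.IsDiag)) : BondConfig V) =
      openGraph ω := by
  ext x y
  simp only [openGraph_adj, Finset.coe_inter, Finset.coe_filter, Finset.mem_univ, true_and, Set.mem_inter_iff, Set.mem_setOf_eq,
    Sym2.mk_isDiag_iff]
  tauto

/-- **The revealed pairs of the full exploration of `C_v` are the non-loop pairs meeting the cluster of `v`.**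
[cite: Gladkov2024, §2 Example 2.5 (p. 3)] -/
theorem mem_revealedAt_cluster_iff (v : V) (ω : BondConfig V) (e : Sym2 V) :
    e ∈ revealedAt (Finset.univ.filter fun e : Sym2 V => ¬ e.IsDiag) {v} (Finset.univ.filter fun e : Sym2 V => e ∈ ω) ↔
      ¬ e.IsDiag ∧ ∃ u ∈ e, (openGraph ω).Reachable v u := by
  rw [mem_revealedAt_iff]
  simp only [Finset.mem_filter, Finset.mem_univ, true_and]
  constructor
  · rintro ⟨hd, u, hu, hue⟩
    rw [mem_reached_iff] at hu
    obtain ⟨s, hs, hsu⟩ := hu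
    rw [Finset.mem_singleton] at hs; subst hs
    rw [openGraph_filter_nonDiag] at hsu
    exact ⟨hd, u, hue, hsu⟩
  · rintro ⟨hd, u, hue, hvu⟩
    refine ⟨hd, u, ?_, hue⟩
    rw [mem_reached_iff]
    refine ⟨v, Finset.mem_singleton_self v, ?_⟩
    rw [openGraph_filter_nonDiag]
    exact hvu

omit [Fintype V] in
/-- Two configurations with the same open edge cluster of `v` have the same vertices joined to `v`. [cite: VandenbergHaggstromKahn2005, §1 p. 3] -/
theorem reachable_iff_of_openEdgeCluster_eq {ω ω' : BondConfig V} {v : V} (h : openEdgeCluster ω' v = openEdgeCluster ω v) (u : V) :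
    (openGraph ω').Reachable v u ↔ (openGraph ω).Reachable v u := by
  rw [reachable_iff_exists_mem_openEdgeCluster, reachable_iff_exists_mem_openEdgeCluster, h]

omit [Fintype V] in
/-- A non-loop open pair with an endpoint joined to `v` lies in the open edge cluster of `v`. [cite: VandenbergHaggstromKahn2005, §1 p. 3] -/
theorem mem_openEdgeCluster_of_mem {ω : BondConfig V} {v u : V} {e : Sym2 V} (he : e ∈ ω) (hd : ¬ e.IsDiag) (hue : u ∈ e)
    (hvu : (openGraph ω).Reachable v u) : e ∈ openEdgeCluster ω v := by
  rw [mem_openEdgeCluster_iff]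
  refine ⟨he, hd, fun z hz => ?_⟩
  by_cases hzu : z = u
  · rw [hzu]; exact hvu
  · have heq : e = s(u, z) := (Sym2.mem_and_mem_iff (Ne.symm hzu)).1 ⟨hue, hz⟩
    exact hvu.trans (SimpleGraph.Adj.reachable ((openGraph_adj ω u z).2 ⟨heq ▸ he, Ne.symm hzu⟩))

/-- **The cylinders of the exploration tree of `C_v` are the events `{C_v = W}`**: a configuration agrees with `ω` on the non-loop
pairs meeting `C_v(ω)` iff it has the same open edge cluster of `v`. [cite: Gladkov2024, Lemma 3.1, Example 2.5 (p. 3)] -/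
theorem cyl_clusterTree_eq (v : V) (ω : BondConfig V) :
    (dtrOfDTree (ttree (Finset.univ.filter fun e : Sym2 V => ¬ e.IsDiag)
        ((Finset.univ.filter fun e : Sym2 V => ¬ e.IsDiag).card + 1) (init {v}))).cyl
        (fun e => {ω' : BondConfig V | e ∈ ω'}) ω =
      {ω' : BondConfig V | openEdgeCluster ω' v = openEdgeCluster ω v} := by
  set D : Finset (Sym2 V) := Finset.univ.filter fun e : Sym2 V => ¬ e.IsDiag with hD
  set K : Finset (Sym2 V) := Finset.univ.filter fun e : Sym2 V => e ∈ ω with hK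
  have hKω : ∀ e, e ∈ K ↔ e ∈ ω := fun e => by simp [hK]
  have hrev : revealed (ttree D (D.card + 1) (init {v})) K = revealedAt D {v} K := (revealedAt_eq_revealed (D := D) {v} K).symm
  rw [cyl_dtrOfDTree _ K ω hKω, hrev]
  ext ω'
  simp only [Set.mem_setOf_eq]
  constructor
  · intro hagree
    -- agreement on the revealed pairs ⇒ same exploration ⇒ same reachable set
    set K' : Finset (Sym2 V) := Finset.univ.filter fun e : Sym2 V => e ∈ ω' with hK'
    have hK'ω : ∀ e, e ∈ K' ↔ e ∈ ω' := fun e => by simp [hK']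
    have hfin := fin_congr (D := D) (N := ({v} : Finset V)) (K := K) (K' := K') fun e he => by
      rw [hKω, hK'ω]; exact (hagree e he).symm
    have hreach : ∀ u, (openGraph ω').Reachable v u ↔ (openGraph ω).Reachable v u := by
      intro u
      have h1 := mem_revealedAt_cluster_iff v ω s(v, u)
      have e1 : u ∈ reached D {v} K' ↔ (openGraph ω').Reachable v u := by
        rw [mem_reached_iff]; simp only [Finset.mem_singleton, exists_eq_left]; rw [hK', openGraph_filter_nonDiag]
      have e2 : u ∈ reached D {v} K ↔ (openGraph ω).Reachable v u := by
        rw [mem_reached_iff]; simp only [Finset.mem_singleton, exists_eq_left]; rw [hK, openGraph_filter_nonDiag]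
      rw [← e1, ← e2, reached, reached, hfin]
    ext e
    rw [mem_openEdgeCluster_iff, mem_openEdgeCluster_iff]
    constructor
    · rintro ⟨he', hd, hr⟩
      have hr' : ∀ u ∈ e, (openGraph ω).Reachable v u := fun u hu => (hreach u).1 (hr u hu)
      induction e using Sym2.ind with
      | h a b =>
        have hrev : s(a, b) ∈ revealedAt D {v} K :=
          (mem_revealedAt_cluster_iff v ω _).2 ⟨hd, a, Sym2.mem_mk_left _ _, hr' a (Sym2.mem_mk_left _ _)⟩
        exact ⟨(hagree _ hrev).1 he', hd, hr'⟩
    · rintro ⟨he, hd, hr⟩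
      have hr' : ∀ u ∈ e, (openGraph ω').Reachable v u := fun u hu => (hreach u).2 (hr u hu)
      induction e using Sym2.ind with
      | h a b =>
        have hrev : s(a, b) ∈ revealedAt D {v} K :=
          (mem_revealedAt_cluster_iff v ω _).2 ⟨hd, a, Sym2.mem_mk_left _ _, hr a (Sym2.mem_mk_left _ _)⟩
        exact ⟨(hagree _ hrev).2 he, hd, hr'⟩
  · intro hC e he
    obtain ⟨hd, u, hue, hvu⟩ := (mem_revealedAt_cluster_iff v ω e).1 he
    have hvu' : (openGraph ω').Reachable v u := (reachable_iff_of_openEdgeCluster_eq hC u).2 hvu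
    constructor
    · intro he'
      have := mem_openEdgeCluster_of_mem he' hd hue hvu'
      rw [hC] at this
      exact openEdgeCluster_subset ω v this
    · intro heω
      have := mem_openEdgeCluster_of_mem heω hd hue hvu
      rw [← hC] at this
      exact openEdgeCluster_subset ω' v this

/-- **The cluster-conditional Harris inequality for `φ_{𝐩,q}`** (`q ≥ 1`): for increasing events `A, A'` and a vertex `v`,
`φ(A)·φ(A') ≤ Σ_ω φ{ω}·φ(A | C_v = C_v(ω))·φ(A' | C_v = C_v(ω))` (`φ = rcMeasureW w q B`; real division) — decision-tree Harris
along the full exploration of the cluster of `v`; the (CE) input of prim-hp-7's Lemma `P_v` for the random-cluster measure.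
[cite: Gladkov2024, Thm. 3.2 (p. 4)] [cite: Grimmett2006, Thm. (3.7) (p. 39), Thm. (3.8)(b)] -/
theorem clusterHarris_rc (w : Sym2 V → unitInterval) {q : ℝ} (hq : 1 ≤ q) (B : Set V) (v : V) {A A' : Set (BondConfig V)}
    (hA : IsUpperSet A) (hA' : IsUpperSet A') :
    (rcMeasureW w q B).real A * (rcMeasureW w q B).real A' ≤
      ∑ ω : BondConfig V, (rcMeasureW w q B).real {ω} *
        ((rcMeasureW w q B).real (A ∩ {ω' | openEdgeCluster ω' v = openEdgeCluster ω v}) /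
          (rcMeasureW w q B).real {ω' | openEdgeCluster ω' v = openEdgeCluster ω v}) *
        ((rcMeasureW w q B).real (A' ∩ {ω' | openEdgeCluster ω' v = openEdgeCluster ω v}) /
          (rcMeasureW w q B).real {ω' | openEdgeCluster ω' v = openEdgeCluster ω v}) := by
  have h := treeHarris_rc w hq B hA hA' (dtrOfDTree (ttree (Finset.univ.filter fun e : Sym2 V => ¬ e.IsDiag)
    ((Finset.univ.filter fun e : Sym2 V => ¬ e.IsDiag).card + 1) (init {v})))
  simp only [cyl_clusterTree_eq] at h
  exact h

end Summit.CriticalPhenomena.PercolationContinuityZ3.Theorems.FK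

end
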